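import Literature.AlgebraicGeometry.ShimuraVarieties.UnitaryBallAutomorphicFubiniStudyExact
import Literature.AlgebraicGeometry.ShimuraVarieties.UnitaryBallPoincareSystem
import Literature.AlgebraicGeometry.ShimuraVarieties.UnitaryBallQuotientSurface
import Literature.AlgebraicGeometry.ShimuraVarieties.UnitaryBallFormPullback
import Literature.AlgebraicGeometry.HodgeTheory.StandardHodgeModel
import Literature.AlgebraicGeometry.HodgeTheory.ComplexConjugationHolds
import Literature.AlgebraicGeometry.HodgeTheory.HodgeRiemannPolarizabilityProofs
import Literature.NumberTheory.Transcendental.DeRhamTheoremMultiplicative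
import Literature.Topology.FourManifolds.ComplexProjectiveSpaceCohomology
import HarnessLib

/-!
# The Kähler–rational datum of a compact ball quotient is stable under Hecke correspondences

Layer `Literature/AlgebraicGeometry/ShimuraVarieties`; sequel of `UnitaryBallAutomorphicFubiniStudyExact` and
`UnitaryBallPoincareSystem`. For a compact ball-quotient datum `D : UnitaryBallUniformisationDatum 2 X`
(`X(ℂ) = Γ\𝔹²`) and a Sylvester frame `𝔣` (arithmetic lattice `Δ = D.ballImage 𝔣 ≤ U(2,1)`), PROVED here
(two definitions with bodies + theorems; no named facts):

* `quotStdCarrier`, `quotModel D 𝔣 : HodgeModel 2 X` — **the quotient Hodge model**: carrier the compact complex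
  surface `Δ\𝔹² = D.quotientSurface 𝔣` (an analytification of `X`, `isAnalytification_quotientSurface`), comparison
  de Rham's integration isomorphism (`integrationDeRhamIsoFamily`, natural ACROSS model spaces,
  `integrationDeRhamIsoFamily_natural₂`), Hodge decomposition transported along the biholomorphism over `X(ℂ)`;
  in it the uniformisation IS the projection (`modelUnif_quotModel`: `ψ = mk`);
* **`exists_kaehlerRationalDatum_fsForm`** — for an immersive projective system `G` of automorphic forms of weight `k`
  (`N ≥ 1`), `[G]^*ω_FS` is the Kähler form of a Kähler metric on `Δ\𝔹²` and its class is `[G]^*[ω_FS]` with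
  `H²(ℂℙᴺ; ℂ) = ℂ · (ρ₀ ⊗ 1)`, `ρ₀` rational (`b₂(ℂℙᴺ) = 1`, `ComplexProjectiveSpace.finrank_singularCohomology_two_mul_eq_one`);
  a Kähler class and a rational class being real, a POSITIVE REAL multiple is rational: there is a
  `KaehlerRationalDatum` `K` of `X` (Voisin I §7.1.2) with `A^*(K.η ⊗ 1) = r · [[G]^*ω_FS] ⊗ 1`, `r > 0`
  — the tree's `exists_fubiniStudy_rational` (Thm. 7.10 surrogate) for the ANALYTIC map `[G]` instead of an
  algebraic projective embedding;
* `pullback_map_eq_ofRealClass_fsForm_twist` — for a morphism `f : X₁ ⟶ X₂` of ball quotients whose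
  analytification lifts to the translation `z ↦ g z` (`g ∈ U(2,1)`, `g Δ₁ g⁻¹ ≤ Δ₂`), `f(ℂ)^*` carries a class
  comparing to `[[G]^*ω_FS] ⊗ 1` to one comparing to `[[S_g G]^*ω_FS] ⊗ 1` (GAGA functoriality `HodgeModel.anMap`,
  naturality of the integration comparison, `BallFS.fsForm_pullback_eq_fsForm_twist`);
* **`exists_kaehlerRationalDatum_map_eq`** — THE COVER-STABLE KÄHLER–RATIONAL DATUM: for every compact
  ball-quotient datum `D₂` there is `K : KaehlerRationalDatum 2 X₂` such that
  `f(ℂ)^* K.η = f'(ℂ)^* K.η ∈ H²(X₁(ℂ); ℚ)` for ANY two morphisms `f, f' : X₁ ⟶ X₂` from another ball quotient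
  lifting to translations of `𝔹²` by `g, g' ∈ U(2,1)` conjugating `Δ₁` into `Δ₂` — in particular for the level leg
  (`g = 1`) and the Hecke leg (`g = γ`) of a Hecke correspondence of Picard modular surfaces, the Kähler-class
  compatibility `f₁^*η = g^*η` needed to make the Hecke operator `τ'_{f₁} ∘ g^*` normal for the polarisation
  `Q_η` of `H¹` (Shimura 1971 §7.2–7.3). Classically `η ∈ ℚ_{>0} · c₁(K_X)` and both legs are étale; the proof here
  uses neither `c₁` nor Chern–Weil: the two pulled-back systems `S_g G`, `S_{g'} G` have the same weight, so their
  Fubini–Study forms are cohomologous (`BallFS.deRhamCohomology_mk_fsForm_eq`).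

## References

* I. R. Shafarevich, *Basic Algebraic Geometry 2* (Springer 1994), Ch. VIII §1.2, Ch. IX §3.1–3.3. [Shafarevich1994]
* P. Griffiths, J. Harris, *Principles of Algebraic Geometry* (1978), Ch. 0 §2, Ch. 1 §2. [GriffithsHarrisPrinciples1978]
* C. Voisin, *Hodge Theory and Complex Algebraic Geometry I* (2002), §3.1.1 Lemma 3.3, §3.1.3, §3.3.2 Lemma 3.16, §7.1.2. [VoisinHodgeI2002]
* G. Shimura, *Introduction to the Arithmetic Theory of Automorphic Functions* (1971), §3.1 Prop. 3.1, §7.2–7.3. [Shimura1971]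

## Provenance

pub-hodgecm2 cell (COR-CM, Hodge ladder stage 2), lane KAEHLER-HECKE-INV (b10): the invariant rational Kähler
class (ℓ) of the Hecke-correspondence line R-A of the S2 crux. Everything here is kernel-checked; no named facts.
-/

set_option autoImplicit false

noncomputable section

open scoped Manifold ContDiff Topology InnerProductSpace ComplexConjugate
open Set Function MulAction Filter Complex
open Literature.Geometry.ComplexHyperbolic
open Literature.Geometry.ComplexHyperbolic.BallModel (U21 Ball)
open Literature.Geometry.Manifold
open Literature.Geometry.Kaehler
open Literature.Topology.FourManifolds
open Literature.NumberTheory.Automorphic.AutomorphyFactor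

namespace Literature.AlgebraicGeometry.ShimuraVarieties

/-! ### The quotient Hodge model of a ball-quotient datum and its Kähler–rational datum -/

namespace UnitaryBallUniformisationDatum

open Literature.AlgebraicGeometry.HodgeTheory Literature.NumberTheory.Transcendental
open Literature.AlgebraicTopology.SingularHomology (singularCohomology)
open Literature.Topology.FourManifolds.ComplexProjectiveSpace (finrank_singularCohomology_two_mul_eq_one
  exists_eq_smul_of_ne_zero)

variable {X : Motives.SchemeOver ℂ} (D : UnitaryBallUniformisationDatum 2 X) (𝔣 : D.SylvesterFrame)

/-- The compact complex surface `Δ\𝔹²` of the datum as a standard analytification of `X`.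
[cite: BergeronMillsonMoeglin2016Balls, Introduction §1.1] -/
def quotStdCarrier : StdCarrier 2 X where
  carrier := D.quotientSurface 𝔣
  toComplexPoints := D.quotientSurfaceHomeomorph 𝔣
  isAnalytification := D.isAnalytification_quotientSurface 𝔣

/-- The Hodge decomposition of `Δ\𝔹²` (transported from a Hodge model of `X` along the biholomorphism
over `X(ℂ)`). [cite: VoisinHodgeI2002, Thm. 6.18 and §7.3.2] -/
theorem isInternal_hodgePQ_quotientSurface (k : ℕ) :
    DirectSum.IsInternal fun pq : ↥(Finset.HasAntidiagonal.antidiagonal k) ↦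
      hodgePQ (Fin 2 → ℂ) (D.quotientSurface 𝔣) k pq.1.1 pq.1.2 := by
  set S := D.quotStdCarrier 𝔣
  set A := BettiUniverse.realHodgeModel exists_isReal_hodgeModel_holds D.isSmoothProjective
  haveI : CompleteSpace A.model := FiniteDimensional.complete ℂ A.model
  haveI : CompleteSpace (Fin 2 → ℂ) := FiniteDimensional.complete ℂ (Fin 2 → ℂ)
  have hf' := S.mdifferentiable_toHodgeModel D.isSmoothProjective A
  have hg' := S.mdifferentiable_ofHodgeModel D.isSmoothProjective A
  exact isInternal_hodgePQ_transport hf'.contMDiff_real_of_complex hf' hg'.contMDiff_real_of_complex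
    hg' (S.ofHodgeModel_toHodgeModel A) (S.toHodgeModel_ofHodgeModel A) (A.isInternal_hodgePQ k)

/-- **The quotient Hodge model** of `X`: carrier `Δ\𝔹²`, comparison de Rham's integration isomorphism.
[cite: BergeronMillsonMoeglin2016Balls, Introduction §1.1] [cite: LeeSmoothManifolds2013, Thm. 18.14] -/
abbrev quotModel : HodgeModel 2 X where
  model := Fin 2 → ℂ
  carrier := D.quotientSurface 𝔣
  toComplexPoints := D.quotientSurfaceHomeomorph 𝔣
  isAnalytification := D.isAnalytification_quotientSurface 𝔣
  deRham := (integrationDeRhamIsoFamily (Fin 2 → ℂ)).complexify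
  deRham_isNatural := DeRhamIsoFamily.complexify_isNatural integrationDeRhamIsoFamily_isNatural
  isInternal_hodgePQ := D.isInternal_hodgePQ_quotientSurface 𝔣

/-- In the quotient model the uniformisation IS the projection: `ψ = mk`.
[cite: BergeronMillsonMoeglin2016Balls, Introduction §1.1] -/
theorem modelUnif_quotModel (z : Ball) :
    D.modelUnif (D.quotModel 𝔣) 𝔣 z.1 = D.quotientSurfaceMk 𝔣 z := by
  rw [modelUnif_coe]
  apply (D.quotModel 𝔣).isAnalytification.homeomorph.injective
  rw [Homeomorph.apply_symm_apply, IsAnalytification.coe_homeomorph]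
  rfl

variable {N k : ℕ} {G : Ball → EuclideanSpace ℂ (Fin (N + 1))}
  (hGh : MDifferentiable 𝓘(ℂ, Fin 2 → ℂ) 𝓘(ℂ, EuclideanSpace ℂ (Fin (N + 1))) G)
  (hG : G ∈ factorForms (D.ballImage 𝔣) (BallForms.canonicalCocycle (EuclideanSpace ℂ (Fin (N + 1))) k)) (h0 : ∀ z, G z ≠ 0)
  (himm : ∀ y : orbitRel.Quotient (D.ballImage 𝔣) Ball, ∃ z : Ball,
    QuotientManifold.mk (G := D.ballImage 𝔣) z = y ∧
      ∀ (u : TangentSpace 𝓘(ℂ, Fin 2 → ℂ) z) (r : ℂ), mvfderiv 𝓘(ℂ, Fin 2 → ℂ) G z u = r • G z → u = 0)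
  (hN : 1 ≤ N)

include hGh himm hN in
/-- **The Kähler–rational datum of an immersive projective system of automorphic forms.** On the
quotient Hodge model, `[G]^*ω_FS` is the Kähler form of a Kähler metric; its class is `[G]^*[ω_FS]`,
and `H²(ℂℙᴺ; ℂ) = ℂ · (rational generator)` (`b₂ = 1`), so a positive real multiple of the class is
RATIONAL: there is a `KaehlerRationalDatum` `K` of `X` and `r > 0` with `A^*(K.η ⊗ 1) = r · [[G]^*ω_FS]`.
[cite: VoisinHodgeI2002, §7.1.2 and Thm. 7.10] [cite: HatcherAT2002, Thm. 3.19] -/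
theorem exists_kaehlerRationalDatum_fsForm :
    ∃ (K : KaehlerRationalDatum 2 X) (r : ℝ), 0 < r ∧
      (D.quotModel 𝔣).pullback 2 (ofRatClass _ 2 K.η) =
        (r : ℂ) • ofRealClass (D.quotientSurface 𝔣) 2
          (integrationDeRhamIsoFamily (Fin 2 → ℂ) (D.quotientSurface 𝔣) 2
            (deRhamCohomology.mk ⟨BallFS.fsForm G hG h0, BallFS.fsForm_mem_closedSmoothForms hGh hG h0⟩)) := by
  set A := D.quotModel 𝔣 with hA
  set e : DeRhamIsoFamily 𝓘(ℝ, Fin 2 → ℂ) := integrationDeRhamIsoFamily (Fin 2 → ℂ) with he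
  set κ : deRhamCohomology 𝓘(ℝ, Fin 2 → ℂ) (D.quotientSurface 𝔣) ℝ 2 :=
    deRhamCohomology.mk ⟨BallFS.fsForm G hG h0, BallFS.fsForm_mem_closedSmoothForms hGh hG h0⟩ with hκ
  -- the Kähler metric with Kähler form `[G]^*ω_FS`
  obtain ⟨g, hg, hgω⟩ := BallFS.exists_isKaehler_kaehlerForm_eq_fsForm hGh hG h0 himm
  have hgκ : g.kaehlerClass (isSmoothForm_kaehlerForm_of_isManifold_complex_holds
      (E := Fin 2 → ℂ) (M := D.quotientSurface 𝔣)) hg = κ := by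
    unfold Bundle.ContMDiffRiemannianMetric.kaehlerClass
    congr 1
    exact Subtype.ext hgω
  -- the class `H` on `X(ℂ)` with `A^* H = e[κ] ⊗ 1`
  obtain ⟨H, hH⟩ := A.pullback_surjective 2 (ofRealClass _ 2 (e (D.quotientSurface 𝔣) 2 κ))
  have hK : A.IsKaehlerClassVia e H := ⟨g, hg, by rw [hH, hgκ]⟩
  -- `e[κ] = [G]^* e_ℙ[ω_FS]`
  have hΦ := BallFS.contMDiff_projMap hGh hG h0
  set Φ : C(D.quotientSurface 𝔣, ComplexProjectiveSpace N) := ⟨BallFS.projMap G hG h0, hΦ.continuous⟩ with hΦdef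
  set cP := ofRealClass (ComplexProjectiveSpace N) 2
    (integrationDeRhamIsoFamily (EuclideanSpace ℝ (Fin (2 * N))) (ComplexProjectiveSpace N) 2
      (deRhamCohomology.mk ⟨fubiniStudyMFormCP N, fubiniStudyMFormCP_mem_closedSmoothForms⟩)) with hcP
  have hnat : ofRealClass _ 2 (e (D.quotientSurface 𝔣) 2 κ) = singularCohomology.map ℂ ℂ Φ 2 cP := by
    have hmap : deRhamCohomology.map hΦ 2
        (deRhamCohomology.mk ⟨fubiniStudyMFormCP N, fubiniStudyMFormCP_mem_closedSmoothForms⟩) = κ := by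
      rw [deRhamCohomology.map_mk]
      rfl
    rw [← hmap, he, integrationDeRhamIsoFamily_natural₂ hΦ 2, ofRealClass_map]
  -- `H²(ℂℙᴺ; ℂ) = ℂ · ρ₀ ⊗ 1` for a rational `ρ₀ ≠ 0`
  have hfin : Module.finrank ℚ (singularCohomology ℚ ℚ (ComplexProjectiveSpace N) 2) = 1 :=
    finrank_singularCohomology_two_mul_eq_one ℚ N 1 hN
  haveI := Module.finite_of_finrank_eq_succ hfin
  obtain ⟨ρ₀, hρ₀⟩ : ∃ ρ₀ : singularCohomology ℚ ℚ (ComplexProjectiveSpace N) 2, ρ₀ ≠ 0 :=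
    Module.finrank_pos_iff_exists_ne_zero.1 (by rw [hfin]; exact one_pos)
  have hx : ofRatClass (ComplexProjectiveSpace N) 2 ρ₀ ≠ 0 := fun h ↦
    hρ₀ (ofRatClass_injective 2 (by rw [h, map_zero]))
  obtain ⟨μ, hμ⟩ := exists_eq_smul_of_ne_zero ℂ (N := N) (k := 1) hN hx cP
  -- the rational class `ρ` on `X(ℂ)` with `A^* ρ = [G]^*(ρ₀ ⊗ 1)`
  set ψ : C(Motives.ComplexPoints X, D.quotientSurface 𝔣) :=
    ⟨(A.isAnalytification.homeomorph.symm : Motives.ComplexPoints X → A.carrier),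
      A.isAnalytification.homeomorph.symm.continuous⟩ with hψ
  set ρ : complexBetti X 2 := singularCohomology.map ℂ ℂ ψ 2
    (singularCohomology.map ℂ ℂ Φ 2 (ofRatClass (ComplexProjectiveSpace N) 2 ρ₀)) with hρ
  have hρrat : IsRationalClass ρ :=
    ((isRationalClass_ofRatClass ρ₀).pullback Φ).pullback ψ
  have hc : ψ.comp ⟨A.toComplexPoints, A.isAnalytification.isHomeomorph.continuous⟩ = ContinuousMap.id _ := by
    ext q
    exact A.isAnalytification.homeomorph.symm_apply_apply q
  have hAρ : A.pullback 2 ρ = singularCohomology.map ℂ ℂ Φ 2 (ofRatClass (ComplexProjectiveSpace N) 2 ρ₀) := by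
    have h1 : singularCohomology.map ℂ ℂ
        (ψ.comp ⟨A.toComplexPoints, A.isAnalytification.isHomeomorph.continuous⟩) 2
        (singularCohomology.map ℂ ℂ Φ 2 (ofRatClass (ComplexProjectiveSpace N) 2 ρ₀)) = A.pullback 2 ρ := by
      rw [singularCohomology.map_comp]
      rfl
    rw [← h1, hc, singularCohomology.map_id]
    rfl
  have hrat : ∃ (ρ' : complexBetti X 2) (μ' : ℂ), IsRationalClass ρ' ∧ H = μ' • ρ' := by
    refine ⟨ρ, μ, hρrat, A.pullback_injective 2 ?_⟩
    rw [hH, hnat, map_smul, hAρ, hμ, map_smul]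
  -- a positive real multiple of `H` is rational (realness of Kähler and rational classes)
  have hrH : ∃ r : ℝ, 0 < r ∧ IsRationalClass ((r : ℂ) • H) := by
    obtain ⟨ρ', μ', hρ', rfl⟩ := hrat
    by_cases hz : μ' • ρ' = 0
    · exact ⟨1, one_pos, by rw [hz, smul_zero]; exact IsRationalClass.zero⟩
    have hconj := hK.conjClass_eq
    rw [conjClass_smul, hρ'.conjClass_eq] at hconj
    have hρ0 : ρ' ≠ 0 := fun h ↦ hz (by rw [h, smul_zero])
    have hμ' : starRingEnd ℂ μ' = μ' := _root_.smul_left_injective ℂ hρ0 hconj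
    have hμre : (μ'.re : ℂ) = μ' := Complex.conj_eq_iff_re.1 hμ'
    have hμ0 : μ'.re ≠ 0 := fun h ↦ hz (by rw [← hμre, h, Complex.ofReal_zero, zero_smul])
    refine ⟨|μ'.re|⁻¹, inv_pos.2 (abs_pos.2 hμ0), ?_⟩
    rw [smul_smul, show ((|μ'.re|⁻¹ : ℝ) : ℂ) * μ' = ((|μ'.re|⁻¹ * μ'.re : ℝ) : ℂ) by
      rw [Complex.ofReal_mul, hμre]]
    rcases lt_or_gt_of_ne hμ0 with hneg | hpos
    · rw [abs_of_neg hneg, inv_neg, neg_mul, inv_mul_cancel₀ hμ0, Complex.ofReal_neg, Complex.ofReal_one]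
      have h := hρ'.smul (-1)
      rwa [Rat.cast_neg, Rat.cast_one] at h
    · rw [abs_of_pos hpos, inv_mul_cancel₀ hμ0, Complex.ofReal_one, one_smul]
      exact hρ'
  obtain ⟨r, hr, hrat'⟩ := hrH
  obtain ⟨η, hη⟩ := (isRationalClass_iff_mem_range_ofRatClass _).1 hrat'
  obtain ⟨g', hg', hg'H⟩ := hK.smul_of_pos hr
  refine ⟨⟨A, e, integrationDeRhamIsoFamily_isNatural, integrationDeRhamIsoFamily_isMultiplicative, g', hg',
    η, by rw [hη]; exact hg'H⟩, r, hr, ?_⟩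
  change A.pullback 2 (ofRatClass _ 2 η) = (r : ℂ) • ofRealClass _ 2 (e (D.quotientSurface 𝔣) 2 κ)
  rw [hη, map_smul, hH]

end UnitaryBallUniformisationDatum

/-! ### Two ball-quotient data: the class of the Kähler–rational datum is stable under morphisms over translations -/

namespace UnitaryBallUniformisationDatum

open Literature.AlgebraicGeometry.HodgeTheory Literature.NumberTheory.Transcendental
open Literature.AlgebraicTopology.SingularHomology (singularCohomology)

variable {X₁ X₂ : Motives.SchemeOver ℂ} (D₁ : UnitaryBallUniformisationDatum 2 X₁)
  (D₂ : UnitaryBallUniformisationDatum 2 X₂) (𝔣₁ : D₁.SylvesterFrame) (𝔣₂ : D₂.SylvesterFrame)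
  {N k : ℕ} {G : Ball → EuclideanSpace ℂ (Fin (N + 1))} (hGh : MDifferentiable 𝓘(ℂ, Fin 2 → ℂ) 𝓘(ℂ, EuclideanSpace ℂ (Fin (N + 1))) G)
  (hG : G ∈ factorForms (D₂.ballImage 𝔣₂) (BallForms.canonicalCocycle (EuclideanSpace ℂ (Fin (N + 1))) k)) (h0 : ∀ z, G z ≠ 0)
  (f : X₁ ⟶ X₂) {g : U21} (hconj : ∀ δ ∈ D₁.ballImage 𝔣₁, g * δ * g⁻¹ ∈ D₂.ballImage 𝔣₂)
  (hf : ∀ z : Ball, HodgeModel.anMap (D₂.quotModel 𝔣₂) (D₁.quotModel 𝔣₁) f (D₁.quotientSurfaceMk 𝔣₁ z) =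
    D₂.quotientSurfaceMk 𝔣₂ (g • z))

include hGh hf in
/-- **Pull-back of the Fubini–Study class along a morphism of ball quotients lifting to a translation.**
For `f : X₁ ⟶ X₂` with `f^an (Δ₁ z) = Δ₂ (g z)` and a class `c ∈ H²(X₂(ℂ); ℂ)` comparing, in the quotient model
of `X₂`, to `[[G]^*ω_FS] ⊗ 1`, the class `f(ℂ)^* c` compares in the quotient model of `X₁` to `[[S_g G]^*ω_FS] ⊗ 1`.
[cite: Shimura1971, §7.2–7.3] [cite: LeeSmoothManifolds2013, Thm. 18.14] -/
theorem pullback_map_eq_ofRealClass_fsForm_twist {c : complexBetti X₂ 2}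
    (hc : (D₂.quotModel 𝔣₂).pullback 2 c = ofRealClass (D₂.quotientSurface 𝔣₂) 2
      (integrationDeRhamIsoFamily (Fin 2 → ℂ) (D₂.quotientSurface 𝔣₂) 2
        (deRhamCohomology.mk ⟨BallFS.fsForm G hG h0, BallFS.fsForm_mem_closedSmoothForms hGh hG h0⟩))) :
    (D₁.quotModel 𝔣₁).pullback 2 (singularCohomology.map ℂ ℂ (Motives.AlgPoints.mapContinuous (L := ℂ) f) 2 c) =
      ofRealClass (D₁.quotientSurface 𝔣₁) 2
        (integrationDeRhamIsoFamily (Fin 2 → ℂ) (D₁.quotientSurface 𝔣₁) 2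
          (deRhamCohomology.mk ⟨BallFS.fsForm (BallFS.twist g G k) (BallFS.twist_mem_factorForms hconj hG)
              (BallFS.twist_ne_zero g h0),
            BallFS.fsForm_mem_closedSmoothForms (BallFS.mdifferentiable_twist g hGh) _ _⟩)) := by
  have hφs : ContMDiff 𝓘(ℝ, Fin 2 → ℂ) 𝓘(ℝ, Fin 2 → ℂ) ∞
      (HodgeModel.anMap (D₂.quotModel 𝔣₂) (D₁.quotModel 𝔣₁) f) :=
    HodgeModel.contMDiff_anMap (D₂.quotModel 𝔣₂) (D₁.quotModel 𝔣₁) f D₁.isSmoothProjective D₂.isSmoothProjective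
  rw [← HodgeModel.map_anMap_pullback, hc, ← ofRealClass_map, ← integrationDeRhamIsoFamily_natural₂ hφs 2,
    BallFS.deRhamCohomology_map_mk_fsForm hGh hG h0 hconj hf hφs]

variable {X₂ : Motives.SchemeOver ℂ} (D₂ : UnitaryBallUniformisationDatum 2 X₂) (𝔣₂ : D₂.SylvesterFrame)

/-- **The cover-stable Kähler–rational datum of a compact ball quotient.** For a compact ball-quotient datum
`D₂` on `X₂` there is a Kähler–rational datum `K` of `X₂` (the Fubini–Study datum of an immersive system
of Poincaré series, `BallProjective.exists_immersive_system` + `exists_kaehlerRationalDatum_fsForm`) whose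
class `K.η ∈ H²(X₂(ℂ); ℚ)` has THE SAME pull-back along any two morphisms `f, f' : X₁ ⟶ X₂` from another
ball quotient `X₁` (same frame matrix) which lift to translations `z ↦ g z`, `z ↦ g' z` of the ball by
elements `g, g'` of `U(2,1)` conjugating `Δ₁` into `Δ₂`: both pull-backs compare, in the quotient model of
`X₁`, to `r · [[S_g G]^*ω_FS]`, resp. `r · [[S_{g'} G]^*ω_FS]`, and two systems of the same weight have
cohomologous Fubini–Study forms (`BallFS.deRhamCohomology_mk_fsForm_eq`). This is the compatibility
`f₁^*η = g^*η` of the Kähler class along the two legs of a Hecke correspondence of Picard modular surfaces.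
[cite: Shimura1971, §3.1 Prop. 3.1, §7.2–7.3] [cite: GriffithsHarrisPrinciples1978, Ch. 0 §2, Ch. 1 §2]
[cite: VoisinHodgeI2002, §7.1.2] -/
theorem exists_kaehlerRationalDatum_map_eq :
    ∃ K : KaehlerRationalDatum 2 X₂,
      ∀ {X₁ : Motives.SchemeOver ℂ} (D₁ : UnitaryBallUniformisationDatum 2 X₁) (𝔣₁ : D₁.SylvesterFrame)
        (f f' : X₁ ⟶ X₂) (g g' : U21)
        (_hconj : ∀ δ ∈ D₁.ballImage 𝔣₁, g * δ * g⁻¹ ∈ D₂.ballImage 𝔣₂)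
        (_hconj' : ∀ δ ∈ D₁.ballImage 𝔣₁, g' * δ * g'⁻¹ ∈ D₂.ballImage 𝔣₂)
        (_hf : ∀ z : Ball, HodgeModel.anMap (D₂.quotModel 𝔣₂) (D₁.quotModel 𝔣₁) f (D₁.quotientSurfaceMk 𝔣₁ z) =
          D₂.quotientSurfaceMk 𝔣₂ (g • z))
        (_hf' : ∀ z : Ball, HodgeModel.anMap (D₂.quotModel 𝔣₂) (D₁.quotModel 𝔣₁) f' (D₁.quotientSurfaceMk 𝔣₁ z) =
          D₂.quotientSurfaceMk 𝔣₂ (g' • z)),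
        singularCohomology.map ℚ ℚ (Motives.AlgPoints.mapContinuous (L := ℂ) f) 2 K.η =
          singularCohomology.map ℚ ℚ (Motives.AlgPoints.mapContinuous (L := ℂ) f') 2 K.η := by
  obtain ⟨N, k, G, hN, -, hGh, hG, h0, himm⟩ := BallProjective.exists_immersive_system (D₂.ballImage 𝔣₂)
  obtain ⟨K, r, hr, hK⟩ := D₂.exists_kaehlerRationalDatum_fsForm 𝔣₂ hGh hG h0 himm hN
  refine ⟨K, fun D₁ 𝔣₁ f f' g g' hconj hconj' hf hf' ↦ ?_⟩
  set c : complexBetti X₂ 2 := ((r : ℂ)⁻¹) • ofRatClass _ 2 K.η with hc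
  have hr0 : (r : ℂ) ≠ 0 := by exact_mod_cast hr.ne'
  have hcc : (D₂.quotModel 𝔣₂).pullback 2 c = ofRealClass (D₂.quotientSurface 𝔣₂) 2
      (integrationDeRhamIsoFamily (Fin 2 → ℂ) (D₂.quotientSurface 𝔣₂) 2
        (deRhamCohomology.mk ⟨BallFS.fsForm G hG h0, BallFS.fsForm_mem_closedSmoothForms hGh hG h0⟩)) := by
    rw [hc, map_smul, hK, smul_smul, inv_mul_cancel₀ hr0, one_smul]
  have h₁ := D₁.pullback_map_eq_ofRealClass_fsForm_twist D₂ 𝔣₁ 𝔣₂ hGh hG h0 f hconj hf hcc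
  have h₂ := D₁.pullback_map_eq_ofRealClass_fsForm_twist D₂ 𝔣₁ 𝔣₂ hGh hG h0 f' hconj' hf' hcc
  rw [BallFS.deRhamCohomology_mk_fsForm_eq (BallFS.mdifferentiable_twist g hGh)
    (BallFS.twist_mem_factorForms hconj hG) (BallFS.twist_ne_zero g h0) (BallFS.mdifferentiable_twist g' hGh)
    (BallFS.twist_mem_factorForms hconj' hG) (BallFS.twist_ne_zero g' h0), ← h₂] at h₁
  have h₃ := (D₁.quotModel 𝔣₁).pullback_injective 2 h₁
  rw [hc, map_smul, map_smul] at h₃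
  have h₄ := smul_right_injective _ (inv_ne_zero hr0) h₃
  apply ofRatClass_injective 2
  rw [ofRatClass, coeffClass_map, coeffClass_map]
  exact h₄

end UnitaryBallUniformisationDatum

end Literature.AlgebraicGeometry.ShimuraVarieties

end
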